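import Summits.Ventures.PercRepro.C026HubTimesTwo

/-!
# Theorem H, part 6: the `(2×)`-slack `Δ₂` under the `abc`-hub — (H3)₂ (p6, gen 12)

* **(H3)₂** `Δ₂(G + v_{abc}) = 4·Δ₂(G) + #{a ≁ b, a ≁ c} + #{a ≁ b, b ≁ c} − 2·(#X_a + #X_b + #Y)`
  with `Y = {a ≁ b} ∩ Λ` (`slack2_hub3_abc`), by the eight `(2×)`-weighted slices (the same
  evaluations as in `C026HubThree.lean` with the weights `2, 1, 1, 2`) and `#Λ = #N_AB + #Y`
  (`card_lambda_split`).

With (H1)₂, (H2)₂ (`C026HubTimesTwo.lean`) this completes the six identities of mine-3's THEOREM H.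
-/

namespace PercRepro

open Finset

namespace MultiGraph

section Hub3TimesTwo

variable {V E : Type*} [Fintype E] (G : MultiGraph V E)

open Classical in
/-- **`Δ₂` of a three-edge hub graph is the sum over its eight hub-state slices.** -/
theorem slack2_hub3_eq (v t₁ t₂ t₃ a b c : V) :
    (G.hub3 v t₁ t₂ t₃).slack2 a b c =
      ((G.hub3 v t₁ t₂ t₃).slice2
          (fun ω : Config E => extendOpt false (extendOpt false (extendOpt false ω))) a b c +
        (G.hub3 v t₁ t₂ t₃).slice2 (fun ω => extendOpt false (extendOpt false (extendOpt true ω))) a b c +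
        ((G.hub3 v t₁ t₂ t₃).slice2 (fun ω => extendOpt false (extendOpt true (extendOpt false ω))) a b c +
          (G.hub3 v t₁ t₂ t₃).slice2 (fun ω => extendOpt false (extendOpt true (extendOpt true ω))) a b c)) +
      ((G.hub3 v t₁ t₂ t₃).slice2 (fun ω => extendOpt true (extendOpt false (extendOpt false ω))) a b c +
        (G.hub3 v t₁ t₂ t₃).slice2 (fun ω => extendOpt true (extendOpt false (extendOpt true ω))) a b c +
        ((G.hub3 v t₁ t₂ t₃).slice2 (fun ω => extendOpt true (extendOpt true (extendOpt false ω))) a b c +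
          (G.hub3 v t₁ t₂ t₃).slice2 (fun ω => extendOpt true (extendOpt true (extendOpt true ω))) a b c)) := by
  have key : 2 * ((univ.filter fun τ : Config (Option (Option (Option E))) =>
        (G.hub3 v t₁ t₂ t₃).Conn τ a b ∧ ¬ (G.hub3 v t₁ t₂ t₃).Conn τ a c).card : ℤ) +
      ((univ.filter fun τ : Config (Option (Option (Option E))) =>
        (G.hub3 v t₁ t₂ t₃).Conn τ c a ∧ ¬ (G.hub3 v t₁ t₂ t₃).Conn τ c b).card : ℤ) +
      ((univ.filter fun τ : Config (Option (Option (Option E))) =>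
        (G.hub3 v t₁ t₂ t₃).Conn τ c b ∧ ¬ (G.hub3 v t₁ t₂ t₃).Conn τ c a).card : ℤ) -
      2 * ((univ.filter fun τ : Config (Option (Option (Option E))) =>
        (G.hub3 v t₁ t₂ t₃).Conn τ a b ∧ ¬ (G.hub3 v t₁ t₂ t₃).Conn τᶜ c a ∧
          ¬ (G.hub3 v t₁ t₂ t₃).Conn τᶜ c b).card : ℤ) =
      ((G.hub3 v t₁ t₂ t₃).slice2
          (fun ω : Config E => extendOpt false (extendOpt false (extendOpt false ω))) a b c +
        (G.hub3 v t₁ t₂ t₃).slice2 (fun ω => extendOpt false (extendOpt false (extendOpt true ω))) a b c +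
        ((G.hub3 v t₁ t₂ t₃).slice2 (fun ω => extendOpt false (extendOpt true (extendOpt false ω))) a b c +
          (G.hub3 v t₁ t₂ t₃).slice2 (fun ω => extendOpt false (extendOpt true (extendOpt true ω))) a b c)) +
      ((G.hub3 v t₁ t₂ t₃).slice2 (fun ω => extendOpt true (extendOpt false (extendOpt false ω))) a b c +
        (G.hub3 v t₁ t₂ t₃).slice2 (fun ω => extendOpt true (extendOpt false (extendOpt true ω))) a b c +
        ((G.hub3 v t₁ t₂ t₃).slice2 (fun ω => extendOpt true (extendOpt true (extendOpt false ω))) a b c +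
          (G.hub3 v t₁ t₂ t₃).slice2 (fun ω => extendOpt true (extendOpt true (extendOpt true ω))) a b c)) := by
    unfold slice2
    rw [card_filter_option3, card_filter_option3, card_filter_option3, card_filter_option3]
    push_cast
    ring
  rw [(G.hub3 v t₁ t₂ t₃).slack2_eq]
  convert key using 9

variable {G}

/-! ### The eight slices -/

open Classical in
/-- Slice `000`: the cells of `G`, no `N_AB`. -/
theorem slice2_hub3_fff {v a b c : V} (hv : G.Isolated v) (hav : a ≠ v) (hbv : b ≠ v)
    (hcv : c ≠ v) :
    (G.hub3 v a b c).slice2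
        (fun ω : Config E => extendOpt false (extendOpt false (extendOpt false ω))) a b c =
      2 * ((univ.filter fun ω : Config E => G.Conn ω a b ∧ ¬ G.Conn ω a c).card : ℤ) +
        ((univ.filter fun ω : Config E => G.Conn ω c a ∧ ¬ G.Conn ω c b).card : ℤ) +
        ((univ.filter fun ω : Config E => G.Conn ω c b ∧ ¬ G.Conn ω c a).card : ℤ) := by
  have key := slice2_eq_of_hubLike
    (R := fun ω x => (false = true ∧ G.Conn ω x a) ∨ (false = true ∧ G.Conn ω x b) ∨
      (false = true ∧ G.Conn ω x c))
    (R' := fun ω x => ((!false) = true ∧ G.Conn ωᶜ x a) ∨ ((!false) = true ∧ G.Conn ωᶜ x b) ∨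
      ((!false) = true ∧ G.Conn ωᶜ x c))
    hav hbv hcv (fun ω => hubLike_hub3 hv hav hbv hcv ω false false false) fun ω => by
      rw [compl_hub3]
      exact hubLike_hub3 hv hav hbv hcv ωᶜ (!false) (!false) (!false)
  rw [key]
  simp only [Bool.not_false, Bool.false_eq_true, false_and, or_false, true_and]
  simp only [closed_triple_iff (a := a) (b := b) (c := c), and_false, Finset.filter_false,
    Finset.card_empty, Nat.cast_zero, mul_zero, sub_zero]

open Classical in
/-- Slice `100`: the cells of `G`, no `N_AB` (`b–v–c` closed puts `b` into `D`). -/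
theorem slice2_hub3_tff {v a b c : V} (hv : G.Isolated v) (hav : a ≠ v) (hbv : b ≠ v)
    (hcv : c ≠ v) :
    (G.hub3 v a b c).slice2
        (fun ω : Config E => extendOpt false (extendOpt false (extendOpt true ω))) a b c =
      2 * ((univ.filter fun ω : Config E => G.Conn ω a b ∧ ¬ G.Conn ω a c).card : ℤ) +
        ((univ.filter fun ω : Config E => G.Conn ω c a ∧ ¬ G.Conn ω c b).card : ℤ) +
        ((univ.filter fun ω : Config E => G.Conn ω c b ∧ ¬ G.Conn ω c a).card : ℤ) := by
  have key := slice2_eq_of_hubLike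
    (R := fun ω x => (true = true ∧ G.Conn ω x a) ∨ (false = true ∧ G.Conn ω x b) ∨
      (false = true ∧ G.Conn ω x c))
    (R' := fun ω x => ((!true) = true ∧ G.Conn ωᶜ x a) ∨ ((!false) = true ∧ G.Conn ωᶜ x b) ∨
      ((!false) = true ∧ G.Conn ωᶜ x c))
    hav hbv hcv (fun ω => hubLike_hub3 hv hav hbv hcv ω true false false) fun ω => by
      rw [compl_hub3]
      exact hubLike_hub3 hv hav hbv hcv ωᶜ (!true) (!false) (!false)
  rw [key]
  simp only [Bool.not_true, Bool.not_false, Bool.false_eq_true, false_and, or_false, false_or,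
    true_and, conn_or_leaf]
  simp only [closed_pair_bc_iff (a := a) (b := b) (c := c), and_false, Finset.filter_false,
    Finset.card_empty, Nat.cast_zero, mul_zero, sub_zero]

open Classical in
/-- Slice `010`: the cells of `G`, no `N_AB` (`a–v–c` closed puts `a` into `D`). -/
theorem slice2_hub3_ftf {v a b c : V} (hv : G.Isolated v) (hav : a ≠ v) (hbv : b ≠ v)
    (hcv : c ≠ v) :
    (G.hub3 v a b c).slice2
        (fun ω : Config E => extendOpt false (extendOpt true (extendOpt false ω))) a b c =
      2 * ((univ.filter fun ω : Config E => G.Conn ω a b ∧ ¬ G.Conn ω a c).card : ℤ) +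
        ((univ.filter fun ω : Config E => G.Conn ω c a ∧ ¬ G.Conn ω c b).card : ℤ) +
        ((univ.filter fun ω : Config E => G.Conn ω c b ∧ ¬ G.Conn ω c a).card : ℤ) := by
  have key := slice2_eq_of_hubLike
    (R := fun ω x => (false = true ∧ G.Conn ω x a) ∨ (true = true ∧ G.Conn ω x b) ∨
      (false = true ∧ G.Conn ω x c))
    (R' := fun ω x => ((!false) = true ∧ G.Conn ωᶜ x a) ∨ ((!true) = true ∧ G.Conn ωᶜ x b) ∨
      ((!false) = true ∧ G.Conn ωᶜ x c))
    hav hbv hcv (fun ω => hubLike_hub3 hv hav hbv hcv ω false true false) fun ω => by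
      rw [compl_hub3]
      exact hubLike_hub3 hv hav hbv hcv ωᶜ (!false) (!true) (!false)
  rw [key]
  simp only [Bool.not_true, Bool.not_false, Bool.false_eq_true, false_and, or_false, false_or,
    true_and, conn_or_leaf]
  simp only [closed_pair_ac_iff (a := a) (b := b) (c := c), and_false, Finset.filter_false,
    Finset.card_empty, Nat.cast_zero, mul_zero, sub_zero]

open Classical in
/-- Slice `001`: `Δ_CF(G)` (a leaf at `c`; `a–v–b` closed changes no event). -/
theorem slice2_hub3_fft {v a b c : V} (hv : G.Isolated v) (hav : a ≠ v) (hbv : b ≠ v)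
    (hcv : c ≠ v) :
    (G.hub3 v a b c).slice2
        (fun ω : Config E => extendOpt true (extendOpt false (extendOpt false ω))) a b c =
      G.slack2 a b c := by
  have key := slice2_eq_of_hubLike
    (R := fun ω x => (false = true ∧ G.Conn ω x a) ∨ (false = true ∧ G.Conn ω x b) ∨
      (true = true ∧ G.Conn ω x c))
    (R' := fun ω x => ((!false) = true ∧ G.Conn ωᶜ x a) ∨ ((!false) = true ∧ G.Conn ωᶜ x b) ∨
      ((!true) = true ∧ G.Conn ωᶜ x c))
    hav hbv hcv (fun ω => hubLike_hub3 hv hav hbv hcv ω false false true) fun ω => by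
      rw [compl_hub3]
      exact hubLike_hub3 hv hav hbv hcv ωᶜ (!false) (!false) (!true)
  rw [key, G.slack2_eq]
  simp only [Bool.not_true, Bool.not_false, Bool.false_eq_true, false_and, or_false, false_or,
    true_and, conn_or_leaf]
  simp only [closed_pair_ab_iff (a := a) (b := b) (c := c)]

open Classical in
/-- Slice `110`: zero (the `ab`-pair slice, a leaf at `c` closed). -/
theorem slice2_hub3_ttf {v a b c : V} (hv : G.Isolated v) (hav : a ≠ v) (hbv : b ≠ v)
    (hcv : c ≠ v) :
    (G.hub3 v a b c).slice2
        (fun ω : Config E => extendOpt false (extendOpt true (extendOpt true ω))) a b c = 0 := by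
  have key := slice2_eq_of_hubLike
    (R := fun ω x => (true = true ∧ G.Conn ω x a) ∨ (true = true ∧ G.Conn ω x b) ∨
      (false = true ∧ G.Conn ω x c))
    (R' := fun ω x => ((!true) = true ∧ G.Conn ωᶜ x a) ∨ ((!true) = true ∧ G.Conn ωᶜ x b) ∨
      ((!false) = true ∧ G.Conn ωᶜ x c))
    hav hbv hcv (fun ω => hubLike_hub3 hv hav hbv hcv ω true true false) fun ω => by
      rw [compl_hub3]
      exact hubLike_hub3 hv hav hbv hcv ωᶜ (!true) (!true) (!false)
  rw [key]
  simp only [Bool.not_true, Bool.not_false, Bool.false_eq_true, false_and, or_false, false_or,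
    true_and, conn_or_leaf]
  simp only [open_pair_ab_conn_iff (a := a) (b := b), open_pair_ab_not_ac_iff (a := a) (b := b) (c := c),
    open_pair_ab_cell_ac_iff (a := a) (b := b) (c := c),
    open_pair_ab_cell_bc_iff (a := a) (b := b) (c := c), Finset.filter_false, Finset.card_empty,
    Nat.cast_zero, add_zero, true_and]
  rw [← mul_sub, mul_eq_zero, sub_eq_zero, Nat.cast_inj]
  right
  convert card_filter_compl (fun ω => ¬ G.Conn ω c a ∧ ¬ G.Conn ω c b) using 2 <;>
    (ext ω; simp only [Finset.mem_filter])

open Classical in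
/-- Slice `101`: the `ac`-pair slice (a leaf at `b` closed). -/
theorem slice2_hub3_tft {v a b c : V} (hv : G.Isolated v) (hav : a ≠ v) (hbv : b ≠ v)
    (hcv : c ≠ v) :
    (G.hub3 v a b c).slice2
        (fun ω : Config E => extendOpt true (extendOpt false (extendOpt true ω))) a b c =
      ((univ.filter fun ω : Config E => ¬ G.Conn ω a b ∧ ¬ G.Conn ω b c).card : ℤ) -
        2 * ((univ.filter fun ω : Config E =>
          (G.Conn ω a b ∨ G.Conn ω c b) ∧ ¬ G.Conn ωᶜ c a ∧ ¬ G.Conn ωᶜ c b).card : ℤ) := by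
  have key := slice2_eq_of_hubLike
    (R := fun ω x => (true = true ∧ G.Conn ω x a) ∨ (false = true ∧ G.Conn ω x b) ∨
      (true = true ∧ G.Conn ω x c))
    (R' := fun ω x => ((!true) = true ∧ G.Conn ωᶜ x a) ∨ ((!false) = true ∧ G.Conn ωᶜ x b) ∨
      ((!true) = true ∧ G.Conn ωᶜ x c))
    hav hbv hcv (fun ω => hubLike_hub3 hv hav hbv hcv ω true false true) fun ω => by
      rw [compl_hub3]
      exact hubLike_hub3 hv hav hbv hcv ωᶜ (!true) (!false) (!true)
  rw [key]
  simp only [Bool.not_true, Bool.not_false, Bool.false_eq_true, false_and, or_false, false_or,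
    true_and, conn_or_leaf]
  simp only [open_pair_ac_not_ac_iff (a := a) (c := c), open_pair_ac_not_ca_iff (a := a) (c := c),
    and_false, Finset.filter_false, Finset.card_empty, Nat.cast_zero, mul_zero, add_zero, zero_add]
  simp only [open_pair_ac_cell_ac_iff (a := a) (b := b) (c := c),
    open_pair_ac_conn_ab_iff (a := a) (b := b) (c := c)]

open Classical in
/-- Slice `011`: the `bc`-pair slice (a leaf at `a` closed). -/
theorem slice2_hub3_ftt {v a b c : V} (hv : G.Isolated v) (hav : a ≠ v) (hbv : b ≠ v)
    (hcv : c ≠ v) :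
    (G.hub3 v a b c).slice2
        (fun ω : Config E => extendOpt true (extendOpt true (extendOpt false ω))) a b c =
      ((univ.filter fun ω : Config E => ¬ G.Conn ω a b ∧ ¬ G.Conn ω a c).card : ℤ) -
        2 * ((univ.filter fun ω : Config E =>
          (G.Conn ω a b ∨ G.Conn ω a c) ∧ ¬ G.Conn ωᶜ c a ∧ ¬ G.Conn ωᶜ c b).card : ℤ) := by
  have key := slice2_eq_of_hubLike
    (R := fun ω x => (false = true ∧ G.Conn ω x a) ∨ (true = true ∧ G.Conn ω x b) ∨
      (true = true ∧ G.Conn ω x c))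
    (R' := fun ω x => ((!false) = true ∧ G.Conn ωᶜ x a) ∨ ((!true) = true ∧ G.Conn ωᶜ x b) ∨
      ((!true) = true ∧ G.Conn ωᶜ x c))
    hav hbv hcv (fun ω => hubLike_hub3 hv hav hbv hcv ω false true true) fun ω => by
      rw [compl_hub3]
      exact hubLike_hub3 hv hav hbv hcv ωᶜ (!false) (!true) (!true)
  rw [key]
  simp only [Bool.not_true, Bool.not_false, Bool.false_eq_true, false_and, or_false, false_or,
    true_and, conn_or_leaf]
  simp only [open_pair_bc_not_cb_iff (b := b) (c := c), and_false, Finset.filter_false,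
    Finset.card_empty, Nat.cast_zero, add_zero]
  simp only [open_pair_bc_conn_ac_iff (a := a) (b := b) (c := c),
    open_pair_bc_cell_bc_iff (a := a) (b := b) (c := c),
    open_pair_bc_conn_ab_iff (a := a) (b := b) (c := c), or_and_not_or_swap_iff,
    Finset.filter_false, Finset.card_empty, Nat.cast_zero, mul_zero, zero_add]

open Classical in
/-- Slice `111`: all three marks joined; only `N_AB = Λ` survives. -/
theorem slice2_hub3_ttt {v a b c : V} (hv : G.Isolated v) (hav : a ≠ v) (hbv : b ≠ v)
    (hcv : c ≠ v) :
    (G.hub3 v a b c).slice2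
        (fun ω : Config E => extendOpt true (extendOpt true (extendOpt true ω))) a b c =
      -(2 * ((univ.filter fun ω : Config E => ¬ G.Conn ωᶜ c a ∧ ¬ G.Conn ωᶜ c b).card : ℤ)) := by
  have key := slice2_eq_of_hubLike
    (R := fun ω x => (true = true ∧ G.Conn ω x a) ∨ (true = true ∧ G.Conn ω x b) ∨
      (true = true ∧ G.Conn ω x c))
    (R' := fun ω x => ((!true) = true ∧ G.Conn ωᶜ x a) ∨ ((!true) = true ∧ G.Conn ωᶜ x b) ∨
      ((!true) = true ∧ G.Conn ωᶜ x c))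
    hav hbv hcv (fun ω => hubLike_hub3 hv hav hbv hcv ω true true true) fun ω => by
      rw [compl_hub3]
      exact hubLike_hub3 hv hav hbv hcv ωᶜ (!true) (!true) (!true)
  rw [key]
  simp only [Bool.not_true, Bool.false_eq_true, false_and, or_false, true_and]
  simp only [open_triple_not_ac_iff (a := a) (b := b) (c := c),
    open_triple_not_cb_iff (a := a) (b := b) (c := c),
    open_triple_not_ca_iff (a := a) (b := b) (c := c),
    open_triple_conn_ab_iff (a := a) (b := b) (c := c), and_false, true_and, Finset.filter_false,
    Finset.card_empty, Nat.cast_zero, mul_zero, add_zero, zero_sub]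

open Classical in
/-- `#Λ = #N_AB + #Y` (`Y = {a ≁ b} ∩ Λ`). -/
theorem card_lambda_split (a b c : V) :
    (univ.filter fun ω : Config E => ¬ G.Conn ωᶜ c a ∧ ¬ G.Conn ωᶜ c b).card =
      (univ.filter fun ω : Config E => G.Conn ω a b ∧ ¬ G.Conn ωᶜ c a ∧ ¬ G.Conn ωᶜ c b).card +
        (univ.filter fun ω : Config E =>
          ¬ G.Conn ω a b ∧ ¬ G.Conn ωᶜ c a ∧ ¬ G.Conn ωᶜ c b).card := by
  rw [Finset.card_filter, Finset.card_filter, Finset.card_filter, ← Finset.sum_add_distrib]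
  refine Finset.sum_congr rfl fun ω _ => ?_
  by_cases hab : G.Conn ω a b <;> simp [hab]

open Classical in
/-- **(H3)₂**: `Δ₂(G + v_{abc}) = 4·Δ₂(G) + #{a ≁ b, a ≁ c} + #{a ≁ b, b ≁ c} − 2·(#X_a + #X_b + #Y)`. -/
theorem slack2_hub3_abc {v a b c : V} (hv : G.Isolated v) (hav : a ≠ v) (hbv : b ≠ v)
    (hcv : c ≠ v) :
    (G.hub3 v a b c).slack2 a b c =
      4 * G.slack2 a b c +
        ((univ.filter fun ω : Config E => ¬ G.Conn ω a b ∧ ¬ G.Conn ω a c).card : ℤ) +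
        ((univ.filter fun ω : Config E => ¬ G.Conn ω a b ∧ ¬ G.Conn ω b c).card : ℤ) -
        2 * (((univ.filter fun ω : Config E =>
            G.Conn ω c a ∧ ¬ G.Conn ω c b ∧ ¬ G.Conn ωᶜ c a ∧ ¬ G.Conn ωᶜ c b).card : ℤ) +
          ((univ.filter fun ω : Config E =>
            G.Conn ω c b ∧ ¬ G.Conn ω c a ∧ ¬ G.Conn ωᶜ c a ∧ ¬ G.Conn ωᶜ c b).card : ℤ) +
          ((univ.filter fun ω : Config E =>
            ¬ G.Conn ω a b ∧ ¬ G.Conn ωᶜ c a ∧ ¬ G.Conn ωᶜ c b).card : ℤ)) := by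
  rw [slack2_hub3_eq, slice2_hub3_fff hv hav hbv hcv, slice2_hub3_tff hv hav hbv hcv,
    slice2_hub3_ftf hv hav hbv hcv, slice2_hub3_fft hv hav hbv hcv,
    slice2_hub3_ttf hv hav hbv hcv, slice2_hub3_tft hv hav hbv hcv,
    slice2_hub3_ftt hv hav hbv hcv, slice2_hub3_ttt hv hav hbv hcv, card_nAB_or_cb_eq,
    card_nAB_or_ac_eq, card_lambda_split, G.slack2_eq]
  push_cast
  ring

end Hub3TimesTwo

end MultiGraph

end PercRepro
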